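import Literature.AlgebraicGeometry.Resolution.AbhyankarEtaleAscentProofs
import Literature.AlgebraicGeometry.Resolution.KnafKuhlmann2005Thm34HenselRoot
import Literature.AlgebraicGeometry.Resolution.AbhyankarRationalUniformization
import Literature.AlgebraicGeometry.Resolution.KnafKuhlmann2009Prop23
import Literature.AlgebraicGeometry.Resolution.ValuedFunctionFieldsLemmas
import Summits.ResolutionOfSingularities.ResolutionOfSingularities.Theorems.ValuativeLuAlphaPTorsorHenselRootChart
import Summits.ResolutionOfSingularities.ResolutionOfSingularities.Theorems.ValuativeLuAlphaPTorsorAdaptedDefs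
import Mathlib.FieldTheory.Minpoly.IsIntegrallyClosed
import Mathlib.RingTheory.Polynomial.UniqueFactorization
import Mathlib.RingTheory.Polynomial.RationalRoot
import Mathlib.RingTheory.Polynomial.ScaleRoots
import HarnessLib

/-!
# Adapted Hensel-root charts: generic helpers

Crux `Valuative.LuAlphaPTorsor` (item `stmt-ResolutionOfSingularities-0641`), line
`pfaff-line-log-final-forms`, helpers for the registered stub `stub_adaptedHenselRootChart`
(F3 of reshape v6.3: the base chart of the level tower, ADAPTED to the flag of convex subgroups
of the value lattice of a zero-dimensional Abhyankar place of arbitrary rank); registered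
helper sub-goal `adHensel_exists_monic_generator`.

* `adHensel_prod_zpow_matrix`, `adHensel_prod_zpow_single` — Laurent monomials in Laurent
  monomials (`∏ⱼ (x^{Cⱼ})^{eⱼ} = x^{e C}`).
* `adHensel_exists_dominant` — the Gauss form of `v` on `k[y]` for `yᵢ ≠ 0` with
  `ℤ`-independent values: `v(P(y))` is the value of a monomial of `P ≠ 0`.
* `adHensel_aeval_mem`, `adHensel_eval₂_mem`, `adHensel_valuation_aeval_sub_const_lt`,
  `adHensel_valuation_eval₂_sub_lt` — values `P(y)`, `G(y; η)` of (iterated) polynomials over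
  `k` lie in any subring containing `k, y, η`, and are congruent to `P(0)`, `G(0; η)` modulo
  `𝔪_O` when `yᵢ ∈ 𝔪_O`.
* `adHensel_eval_sub_eval_mem_sp`, `adHensel_aeval_sub_aeval_lo_mem_sp`,
  `adHensel_small_of_mem_sp` — the span `(x_{≥ℓ}) S` of the variables of level `≥ ℓ` (in the
  set rendering of `…HenselRootChartHelpers`): killing those variables changes `P(x)` by an
  element of the span; its elements are smaller than every Laurent monomial of level `< ℓ`.
* `adHensel_exists_monic_generator` — for an integrally closed domain `S`, a prime
  `{g ∈ S[T] : g(η) small}` lying over `0` and containing a monic `F` is generated by a monic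
  `m` with `F = m c` (minimal polynomial over `S` of the class of `T`, Gauss's lemma
  `minpoly.isIntegrallyClosed_dvd`).
-/

-- single-problem summit: the doubled namespace component `ResolutionOfSingularities` is forced
set_option linter.dupNamespace false

namespace Summit.ResolutionOfSingularities.ResolutionOfSingularities.Theorems.PfaffLine

open IsLocalRing Polynomial Literature.AlgebraicGeometry.Resolution

/-! ### Laurent monomials -/

/-- `∏ⱼ (∏ᵢ aᵢ^{C j i})^{e j} = ∏ᵢ aᵢ^{∑ⱼ e j C j i}` for non-zero `aᵢ`. [folklore] -/
theorem adHensel_prod_zpow_matrix {G : Type} [CommGroupWithZero G] {n : ℕ} (a : Fin n → G)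
    (ha : ∀ i, a i ≠ 0) (C : Matrix (Fin n) (Fin n) ℤ) (e : Fin n → ℤ) :
    (∏ j, (∏ i, a i ^ (C j i)) ^ (e j)) = ∏ i, a i ^ (∑ j, e j * C j i) := by
  have hsum : ∀ (b : G), b ≠ 0 → ∀ (f : Fin n → ℤ) (s : Finset (Fin n)),
      b ^ (∑ j ∈ s, f j) = ∏ j ∈ s, b ^ (f j) := by
    intro b hb f s
    classical
    induction s using Finset.induction_on with
    | empty => simp
    | insert j s hj ih => rw [Finset.sum_insert hj, Finset.prod_insert hj, zpow_add₀ hb, ih]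
  have h1 : ∀ j, (∏ i, a i ^ (C j i)) ^ (e j) = ∏ i, a i ^ (e j * C j i) := by
    intro j
    rw [← Finset.prod_zpow]
    refine Finset.prod_congr rfl fun i _ => ?_
    rw [← zpow_mul, mul_comm]
  simp_rw [h1]
  rw [Finset.prod_comm]
  exact Finset.prod_congr rfl fun i _ => (hsum (a i) (ha i) _ _).symm

/-- `∏ⱼ aⱼ^{δᵢⱼ} = aᵢ`. [folklore] -/
theorem adHensel_prod_zpow_single {G : Type} [CommGroupWithZero G] {n : ℕ} (a : Fin n → G)
    (i : Fin n) : (∏ j, a j ^ ((Pi.single i 1 : Fin n → ℤ) j)) = a i := by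
  classical
  rw [Finset.prod_eq_single i]
  · simp
  · intro j _ hj
    simp [hj]
  · intro h
    exact absurd (Finset.mem_univ i) h

/-! ### The Gauss form of `v` on `k[y]` for value-independent `y` -/

/-- For `yᵢ ≠ 0` with `ℤ`-independent values and `k ⊆ O`, a non-zero `P ∈ k[Y]` has value
`v(P(y)) = v(y^μ)` for some monomial `μ` of `P`. [folklore] -/
theorem adHensel_exists_dominant {k K : Type} [Field k] [Field K] [Algebra k K]
    (O : ValuationSubring K) (hk : ∀ c : k, algebraMap k K c ∈ O) {σ : Type} [Fintype σ]
    (y : σ → K) (hy0 : ∀ i, y i ≠ 0)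
    (hyi : ∀ m : σ → ℤ, (∏ i, O.valuation (y i) ^ (m i)) = 1 → m = 0)
    (P : MvPolynomial σ k) (hP : P ≠ 0) :
    ∃ μ ∈ P.support, O.valuation (MvPolynomial.aeval y P) = ∏ i, O.valuation (y i) ^ (μ i) := by
  classical
  have hv0 : ∀ i, O.valuation (y i) ≠ 0 := fun i => (map_ne_zero O.valuation).mpr (hy0 i)
  have hval1 : ∀ c : k, c ≠ 0 → O.valuation (algebraMap k K c) = 1 := by
    intro c hc
    refine le_antisymm ((O.valuation_le_one_iff _).mpr (hk c)) ?_
    have h := (O.valuation_le_one_iff _).mpr (hk c⁻¹)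
    rwa [map_inv₀, map_inv₀, inv_le_one₀ (zero_lt_iff.mpr ((map_ne_zero O.valuation).mpr
      ((map_ne_zero (algebraMap k K)).mpr hc)))] at h
  have hinj : ∀ μ ν : σ →₀ ℕ, (∏ i, O.valuation (y i) ^ (μ i)) = ∏ i, O.valuation (y i) ^ (ν i) →
      μ = ν := by
    intro μ ν h
    have h1 : (∏ i, O.valuation (y i) ^ ((μ i : ℤ) - ν i)) = 1 := by
      simp_rw [zpow_sub₀ (hv0 _), zpow_natCast]
      rw [Finset.prod_div_distrib, h, div_self]
      exact Finset.prod_ne_zero_iff.mpr fun i _ => pow_ne_zero _ (hv0 i)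
    have h2 := hyi _ h1
    ext i
    have h3 := congr_fun h2 i
    simp only [Pi.zero_apply, sub_eq_zero, Nat.cast_inj] at h3
    exact h3
  set t : (σ →₀ ℕ) → K := fun μ => algebraMap k K (P.coeff μ) * ∏ i, y i ^ (μ i) with ht
  have haeval : MvPolynomial.aeval y P = ∑ μ ∈ P.support, t μ := by
    rw [MvPolynomial.aeval_def, MvPolynomial.eval₂_eq']
  have hvt : ∀ μ ∈ P.support, O.valuation (t μ) = ∏ i, O.valuation (y i) ^ (μ i) := by
    intro μ hμ
    rw [ht]
    dsimp only
    rw [map_mul, hval1 _ (MvPolynomial.mem_support_iff.mp hμ), one_mul, map_prod]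
    simp_rw [map_pow]
  obtain ⟨μ₀, hμ₀, hmax⟩ := P.support.exists_max_image
    (fun μ => ∏ i, O.valuation (y i) ^ (μ i)) (MvPolynomial.support_nonempty.mpr hP)
  refine ⟨μ₀, hμ₀, ?_⟩
  rw [haeval, Valuation.map_sum_eq_of_lt _ hμ₀, hvt μ₀ hμ₀]
  intro μ hμ
  rw [Finset.mem_sdiff, Finset.mem_singleton] at hμ
  rw [hvt μ hμ.1, hvt μ₀ hμ₀]
  exact lt_of_le_of_ne (hmax μ hμ.1) fun h => hμ.2 (hinj μ μ₀ h)

/-! ### Values of polynomials over `k[y]` -/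

section Eval

variable {k K : Type} [Field k] [Field K] [Algebra k K]

/-- `P(y) ∈ T` for a subring `T ∋ yᵢ` containing the image of `k`. [folklore] -/
theorem adHensel_aeval_mem {σ τ : Type} [SetLike τ K] [SubringClass τ K] (T : τ)
    (hT : ∀ c : k, algebraMap k K c ∈ T) {y : σ → K} (hy : ∀ i, y i ∈ T) (P : MvPolynomial σ k) :
    MvPolynomial.aeval y P ∈ T := by
  induction P using MvPolynomial.induction_on with
  | C a => rw [MvPolynomial.algHom_C]; exact hT a
  | add p q hp hq => rw [map_add]; exact add_mem hp hq
  | mul_X p i hp => rw [map_mul, MvPolynomial.aeval_X]; exact mul_mem hp (hy i)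

/-- `G(y; η) ∈ T` for a subring `T ∋ yᵢ, η` containing the image of `k`. [folklore] -/
theorem adHensel_eval₂_mem {σ τ : Type} [SetLike τ K] [SubringClass τ K] (T : τ)
    (hT : ∀ c : k, algebraMap k K c ∈ T) {y : σ → K} (hy : ∀ i, y i ∈ T) {η : K} (hη : η ∈ T)
    (G : (MvPolynomial σ k)[X]) : G.eval₂ (MvPolynomial.aeval y).toRingHom η ∈ T := by
  rw [eval₂_eq_sum_range]
  exact sum_mem fun i _ => mul_mem (adHensel_aeval_mem T hT hy _) (pow_mem hη i)

/-- `v(P(y) - P(0)) < 1` when `yᵢ ∈ 𝔪_O`. [folklore] -/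
theorem adHensel_valuation_aeval_sub_const_lt (O : ValuationSubring K)
    (hk : ∀ c : k, algebraMap k K c ∈ O) {σ : Type} {y : σ → K} (hyO : ∀ i, y i ∈ O)
    (hvy : ∀ i, O.valuation (y i) < 1) (P : MvPolynomial σ k) :
    O.valuation (MvPolynomial.aeval y P - algebraMap k K (MvPolynomial.constantCoeff P)) < 1 := by
  induction P using MvPolynomial.induction_on with
  | C a =>
    rw [MvPolynomial.algHom_C, MvPolynomial.constantCoeff_C, sub_self, map_zero]
    exact zero_lt_one
  | add p q hp hq =>
    rw [map_add, map_add, map_add, add_sub_add_comm]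
    exact Valuation.map_add_lt _ hp hq
  | mul_X p i hp =>
    rw [map_mul, MvPolynomial.aeval_X, map_mul, MvPolynomial.constantCoeff_X, mul_zero, map_zero,
      sub_zero, map_mul]
    exact mul_lt_of_le_one_of_lt ((O.valuation_le_one_iff _).mpr (adHensel_aeval_mem O hk hyO p))
      (hvy i)

/-- `v(G(y; η) - G(0; η)) < 1` when `yᵢ ∈ 𝔪_O`, `η ∈ O`. [folklore] -/
theorem adHensel_valuation_eval₂_sub_lt (O : ValuationSubring K)
    (hk : ∀ c : k, algebraMap k K c ∈ O) {σ : Type} {y : σ → K} (hyO : ∀ i, y i ∈ O)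
    (hvy : ∀ i, O.valuation (y i) < 1) {η : K} (hη : η ∈ O) (G : (MvPolynomial σ k)[X]) :
    O.valuation (G.eval₂ (MvPolynomial.aeval y).toRingHom η -
      aeval η (G.map MvPolynomial.constantCoeff)) < 1 := by
  have h1 : G.eval₂ (MvPolynomial.aeval y).toRingHom η =
      ∑ i ∈ Finset.range (G.natDegree + 1), MvPolynomial.aeval y (G.coeff i) * η ^ i :=
    eval₂_eq_sum_range _ _
  have h2 : aeval η (G.map MvPolynomial.constantCoeff) = ∑ i ∈ Finset.range (G.natDegree + 1),
      algebraMap k K (MvPolynomial.constantCoeff (G.coeff i)) * η ^ i := by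
    rw [aeval_def, eval₂_eq_sum_range' (algebraMap k K)
      (Nat.lt_succ_of_le (natDegree_map_le)) η]
    simp only [coeff_map]
  rw [h1, h2, ← Finset.sum_sub_distrib]
  refine Valuation.map_sum_lt _ one_ne_zero fun i _ => ?_
  rw [← sub_mul, map_mul, map_pow, mul_comm]
  exact mul_lt_of_le_one_of_lt (pow_le_one' ((O.valuation_le_one_iff _).mpr hη) i)
    (adHensel_valuation_aeval_sub_const_lt O hk hyO hvy _)

end Eval

/-! ### Spans of parameters: two more closure properties -/

section Span

variable {k K : Type} [Field k] [Field K] [Algebra k K] {n : ℕ}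

/-- Polynomials over `K` with coefficients congruent modulo `(x) S` have congruent values at
`η ∈ S`. [folklore] -/
theorem adHensel_eval_sub_eval_mem_sp {x : Fin n → K} {τ : Type} [SetLike τ K] [SubringClass τ K]
    {S : τ} {η : K} (hη : η ∈ S) {P Q : K[X]}
    (h : ∀ i, P.coeff i - Q.coeff i ∈ {z | ∃ r : Fin n → K, (∀ i, r i ∈ S) ∧ z = ∑ i, r i * x i}) :
    P.eval η - Q.eval η ∈ {z | ∃ r : Fin n → K, (∀ i, r i ∈ S) ∧ z = ∑ i, r i * x i} := by
  rw [eval_eq_sum_range' (n := max P.natDegree Q.natDegree + 1) (by omega) η,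
    eval_eq_sum_range' (n := max P.natDegree Q.natDegree + 1) (by omega) η,
    ← Finset.sum_sub_distrib]
  refine sum_mem_sp _ fun i _ => ?_
  rw [← sub_mul]
  exact mul_mem_sp_right (h i) (pow_mem hη i)

/-- Killing the variables of level `≥ ℓ` changes `P(x)` by an element of the span of those
variables. [folklore] -/
theorem adHensel_aeval_sub_aeval_lo_mem_sp (x : Fin n → K) (lv : Fin n → ℕ) (ℓ : ℕ) {τ : Type}
    [SetLike τ K] [SubringClass τ K] (T : τ) (hT : ∀ c : k, algebraMap k K c ∈ T)
    (hxT : ∀ i, x i ∈ T) (P : MvPolynomial (Fin n) k) :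
    MvPolynomial.aeval x P - MvPolynomial.aeval (fun i => if lv i < ℓ then x i else 0) P ∈
      {z | ∃ r : Fin n → K, (∀ i, r i ∈ T) ∧ z = ∑ i, r i * (if lv i < ℓ then 0 else x i)} := by
  induction P using MvPolynomial.induction_on with
  | C a => rw [MvPolynomial.algHom_C, MvPolynomial.algHom_C, sub_self]; exact zero_mem_sp T
  | add p q hp hq => rw [map_add, map_add, add_sub_add_comm]; exact add_mem_sp hp hq
  | mul_X p i hp =>
    rw [map_mul, map_mul, MvPolynomial.aeval_X, MvPolynomial.aeval_X]
    by_cases hi : lv i < ℓ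
    · rw [if_pos hi, ← sub_mul]
      exact mul_mem_sp_right hp (hxT i)
    · rw [if_neg hi, mul_zero, sub_zero]
      have h := mul_mem_sp_left (x := fun i => if lv i < ℓ then 0 else x i)
        (adHensel_aeval_mem T hT hxT p) (self_mem_sp T i)
      simp only [if_neg hi] at h
      exact h

/-- Elements of the span of the variables of level `≥ ℓ` (coefficients in `S ⊆ O`) are smaller
than every Laurent monomial of level `< ℓ`, once the variables are. [folklore] -/
theorem adHensel_small_of_mem_sp (O : ValuationSubring K) (x : Fin n → K) (hx0 : ∀ i, x i ≠ 0)
    (lv : Fin n → ℕ) (ℓ : ℕ)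
    (hhi : ∀ i, ℓ ≤ lv i → ∀ m : Fin n → ℤ, (∀ j, ℓ ≤ lv j → m j = 0) →
      O.valuation (x i) < ∏ j, O.valuation (x j) ^ (m j))
    {τ : Type} [SetLike τ K] {S : τ} (hS : ∀ s ∈ S, s ∈ O) {z : K}
    (hz : z ∈ {z | ∃ r : Fin n → K, (∀ i, r i ∈ S) ∧ z = ∑ i, r i * (if lv i < ℓ then 0 else x i)}) :
    ∀ m : Fin n → ℤ, (∀ j, ℓ ≤ lv j → m j = 0) →
      O.valuation z < ∏ j, O.valuation (x j) ^ (m j) := by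
  intro m hm
  have hprod0 : (∏ j, O.valuation (x j) ^ (m j)) ≠ 0 :=
    Finset.prod_ne_zero_iff.mpr fun j _ => zpow_ne_zero _ ((map_ne_zero O.valuation).mpr (hx0 j))
  obtain ⟨r, hr, rfl⟩ := hz
  refine Valuation.map_sum_lt _ hprod0 fun i _ => ?_
  rw [map_mul]
  refine mul_lt_of_le_one_of_lt ((O.valuation_le_one_iff _).mpr (hS _ (hr i))) ?_
  split_ifs with hi
  · rw [map_zero]
    exact zero_lt_iff.mpr hprod0
  · exact hhi i (not_lt.mp hi) m hm

end Span

/-! ### A prime of `S[X]` over `0`, containing a monic polynomial, is principal -/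

/-- **Registered anchor.** Let `S` be an integrally closed domain, `φ : S → L`, `η ∈ L`, and
`small` a predicate on `L` such that `{g ∈ S[X] : small (g(η))}` is a prime ideal meeting `S`
only in `0`; if it contains a monic `F`, then it is generated by a monic `m` with `F = m c`
(`m` is the minimal polynomial over `S` of the class of `X` in the quotient domain, by Gauss's
lemma `minpoly.isIntegrallyClosed_dvd`). [folklore] -/
theorem adHensel_exists_monic_generator :
    ∀ (S L : Type) [CommRing S] [IsDomain S] [IsIntegrallyClosed S] [CommRing L] (φ : S →+* L) (η : L) (small : L → Prop), small 0 → (∀ a b : L, small a → small b → small (a + b)) → (∀ (g : Polynomial S) (b : L), small b → small (Polynomial.eval₂ φ η g * b)) → (∀ g h : Polynomial S, small (Polynomial.eval₂ φ η (g * h)) → small (Polynomial.eval₂ φ η g) ∨ small (Polynomial.eval₂ φ η h)) → (∀ c : S, small (φ c) → c = 0) → ∀ F : Polynomial S, F.Monic → small (Polynomial.eval₂ φ η F) → ∃ m c : Polynomial S, m.Monic ∧ F = m * c ∧ small (Polynomial.eval₂ φ η m) ∧ ∀ g : Polynomial S, small (Polynomial.eval₂ φ η g) → m ∣ g := by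
  intro S L _ _ _ _ φ η small h0 hadd hmul hprime hconst F hF hFs
  classical
  let I : Ideal S[X] :=
    { carrier := {g | small (g.eval₂ φ η)}
      add_mem' := fun {a b} ha hb => by
        simp only [Set.mem_setOf_eq, eval₂_add]
        exact hadd _ _ ha hb
      zero_mem' := by simpa only [Set.mem_setOf_eq, eval₂_zero] using h0
      smul_mem' := fun c {g} hg => by
        simp only [Set.mem_setOf_eq, smul_eq_mul, eval₂_mul]
        exact hmul c _ hg }
  have hI : ∀ g, g ∈ I ↔ small (g.eval₂ φ η) := fun g => Iff.rfl
  have hIprime : I.IsPrime := by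
    refine ⟨?_, fun {g h} hgh => hprime g h ((hI _).mp hgh)⟩
    rw [Ideal.ne_top_iff_one, hI, eval₂_one, ← φ.map_one]
    intro h1
    exact one_ne_zero (hconst 1 h1)
  haveI : IsDomain (S[X] ⧸ I) := (Ideal.Quotient.isDomain_iff_prime I).mpr hIprime
  set θ : S[X] ⧸ I := Ideal.Quotient.mk I X with hθ
  have hmk : ∀ g : S[X], aeval θ g = Ideal.Quotient.mk I g := by
    intro g
    have h1 : (Ideal.Quotient.mkₐ S I : S[X] →ₐ[S] S[X] ⧸ I) X = θ := rfl
    rw [← h1, aeval_algHom_apply, aeval_X_left_apply]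
    rfl
  have hinj : Function.Injective (algebraMap S (S[X] ⧸ I)) := by
    intro a b hab
    rw [← sub_eq_zero]
    apply hconst
    have h1 : Ideal.Quotient.mk I (C (a - b)) = 0 := by
      rw [map_sub, map_sub, sub_eq_zero]
      exact hab
    rw [Ideal.Quotient.eq_zero_iff_mem, hI, eval₂_C] at h1
    exact h1
  haveI : Module.IsTorsionFree S (S[X] ⧸ I) :=
    Module.isTorsionFree_iff_algebraMap_injective.mpr hinj
  have hθint : IsIntegral S θ := by
    refine ⟨F, hF, ?_⟩
    rw [← aeval_def, hmk, Ideal.Quotient.eq_zero_iff_mem]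
    exact hFs
  have hmI : minpoly S θ ∈ I := by
    rw [← Ideal.Quotient.eq_zero_iff_mem, ← hmk]
    exact minpoly.aeval S θ
  have hdvd : ∀ g : S[X], small (g.eval₂ φ η) → minpoly S θ ∣ g := fun g hg =>
    minpoly.isIntegrallyClosed_dvd hθint (by rw [hmk, Ideal.Quotient.eq_zero_iff_mem]; exact hg)
  obtain ⟨c, hc⟩ := hdvd F hFs
  exact ⟨minpoly S θ, c, minpoly.monic hθint, hc, hmI, hdvd⟩

end Summit.ResolutionOfSingularities.ResolutionOfSingularities.Theorems.PfaffLine
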